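import Summits.Ventures.YMGap.Thresholds.LinearResponseBound
import Summits.Ventures.YMGap.RobustBall.RowsSU2
import HarnessLib

/-!
# Venture YMGap, track ROBUST-BALL — C-SUS ON THE BALL: finite plaquette susceptibility and the extensive energy-variance bound
# for every DLR state of every member of the tier-1 `ℤ^d` ball, from rb-p1's currency `PerturbedMassGapAt` / `MassGapOnBallZd`

HONEST FRAMING: venture file of the cell `pub-ymgap` (QuantumFields programme), track Y2 ROBUST-BALL, seat ds-1; the ball twin of
`Thresholds/PlaquetteSusceptibility.lean` / `PlaquetteEnergyVariance.lean`.  Strong-coupling LATTICE statements for the perturbed actions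
`N β S_W + W` of rb-p1's ball; corollaries of the member's clustering clause (`PerturbedMassGapAt`, Shen–Zhu–Zhu shape) — the SAME lattice-sum
argument as for the Wilson action; nothing about the continuum or the Clay problem.

* `summable_abs_cov_plaquette_of_perturbedMassGapAt` — `PerturbedMassGapAt d N β W supp` ⇒ for every DLR state `μ` of the member one `χ`
  with `Σ_q |Cov_μ(W_p, W_q)| ≤ χ` (summable over all plaquettes) for every plaquette `p`.
* `variance_sum_plaquette_le_of_perturbedMassGapAt` — and `Var_μ(Σ_{p∈P} W_p) ≤ χ · #P` for every finite plaquette set `P`.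
* `summable_abs_cov_plaquette_of_massGapOnBallZd` / `variance_sum_plaquette_le_of_massGapOnBallZd` — uniformly over the ball
  `MassGapOnBallZd d N β ε₀ ε₁ R`: every member `MemBallZd ε₀ ε₁ R W supp`, every DLR state.
* `su2_summable_abs_cov_plaquette_ball_1_8` — the LEAD CELL of the data cut, `SU(2)`, `ℤ⁴`, `(β_W, ε) = (1/8, 0.143)` (rb-p1's `su2_rowB_1_8`):
  every DLR state of every member of `MemBallZd (2·0.143) 0.143 R` at bare coupling `1/16` has finite plaquette susceptibility and the extensive
  energy-variance bound — hypothesis-free.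

References (mechanism): H. Shen, R. Zhu, X. Zhu, CMP 400 (2023), Cor. 1.6; B. Simon, *The Statistical Mechanics of Lattice Gases* I (1993), §II.12.
-/

noncomputable section

open MeasureTheory Function Finset ProbabilityTheory Real
open scoped NNReal
open Literature.Probability.LatticeModels
open Literature.MathematicalPhysics.QuantumLattice (fundamentalRep fundamentalRep_mem_unitaryGroup LGConfig ZdEdge ZdPlaquette)
open Literature.MathematicalPhysics.QuantumFieldTheory hiding ZdEdge
open Summit.Ventures.YMGap.RobustBall (l1 numOrient perturbedYM perturbedGibbsMeasures PerturbedMassGapAt MemBallZd MassGapOnBallZd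
  su2_rowB_1_8)
open Summit.Ventures.YMGap.PlaquetteSusceptibility (exp_neg_latticeNorm_le_pow)
open Summit.Ventures.YMGap.LinearResponseBound (summable_and_tsum_base_le)

namespace Summit.Ventures.YMGap.RobustBall.PlaquetteSusceptibilityBall

variable {d N : ℕ}

/-- **C-SUS for a ball member.**  `PerturbedMassGapAt d N β W supp` (`d ≥ 1`) ⇒ for every DLR state `μ` of the member `N β S_W + W` there is
one `χ` with: for every plaquette `p`, `q ↦ |Cov_μ(W_p, W_q)|` is summable over all plaquettes of `ℤ^d` and `Σ_q |Cov_μ(W_p, W_q)| ≤ χ`.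
[cite: arXiv220412737, Cor. 1.6 (Mass gap)] -/
theorem summable_abs_cov_plaquette_of_perturbedMassGapAt (hd : 1 ≤ d) {β : ℝ}
    {W : Potential (ZdEdge d) (Matrix.specialUnitaryGroup (Fin N) ℂ)} {supp : Finset (ZdEdge d) → Finset (Finset (ZdEdge d))}
    (h : PerturbedMassGapAt d N β W supp) {μ : Measure (LGConfig d (Matrix.specialUnitaryGroup (Fin N) ℂ))}
    (hμ : μ ∈ perturbedGibbsMeasures (d := d) (fundamentalRep (Fin N)) (N * β) W supp) :
    ∃ χ : ℝ, ∀ p : ZdPlaquette d,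
      Summable (fun q : ZdPlaquette d => |cov[zdPlaquetteObs (fundamentalRep (Fin N)) p.1 p.2.1.1 p.2.1.2,
        zdPlaquetteObs (fundamentalRep (Fin N)) q.1 q.2.1.1 q.2.1.2; μ]|) ∧
        ∑' q : ZdPlaquette d, |cov[zdPlaquetteObs (fundamentalRep (Fin N)) p.1 p.2.1.1 p.2.1.2,
        zdPlaquetteObs (fundamentalRep (Fin N)) q.1 q.2.1.1 q.2.1.2; μ]| ≤ χ := by
  classical
  have hμ' : IsGibbsMeasure (perturbedYM (d := d) (fundamentalRep (Fin N)) (N * β) W supp) μ := hμ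
  haveI := hμ'.isProbabilityMeasure
  obtain ⟨c, hc, hn⟩ := h.2 μ hμ
  obtain ⟨c₁, hc₁⟩ := hn 4
  set C' : ℝ := max (max c₁ 0 * Real.exp (2 * c) *
      (((4 * (N : ℝ≥0) ^ 3 : ℝ≥0) : ℝ) * ((4 * (N : ℝ≥0) ^ 3 : ℝ≥0) : ℝ) + 1)) (4 * Real.exp (2 * c)) with hC'
  have hC'0 : 0 ≤ C' := le_max_of_le_right (by positivity)
  have hdpos : (0 : ℝ) < d := by exact_mod_cast (show 0 < d by omega)
  set r : ℝ := exp (-(c / Real.sqrt d / d)) with hr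
  have hr0 : 0 ≤ r := (exp_pos _).le
  have hr1 : r < 1 := by rw [hr]; exact Real.exp_lt_one_iff.2 (neg_neg_of_pos (by positivity))
  refine ⟨C' * (numOrient d * ((1 + r) / (1 - r)) ^ d), fun p => ?_⟩
  have hpt : ∀ q : ZdPlaquette d, |cov[zdPlaquetteObs (fundamentalRep (Fin N)) p.1 p.2.1.1 p.2.1.2,
      zdPlaquetteObs (fundamentalRep (Fin N)) q.1 q.2.1.1 q.2.1.2; μ]| ≤ C' * r ^ l1 (p.1 - q.1) := by
    intro q
    have hdec := abs_cov_zdPlaquetteObs_le_of_decay (N := N) (by omega) hc hc₁ p.1 q.1 p.2.2 q.2.2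
    refine hdec.trans (mul_le_mul_of_nonneg_left ?_ hC'0)
    have := exp_neg_latticeNorm_le_pow hd (div_pos hc (Real.sqrt_pos.2 hdpos)).le (p.1 - q.1)
    simpa only [hr, neg_mul] using this
  have hrow := summable_and_tsum_base_le (d := d) hC'0 hr0 hr1 p.1
  have hsum : Summable fun q : ZdPlaquette d => |cov[zdPlaquetteObs (fundamentalRep (Fin N)) p.1 p.2.1.1 p.2.1.2,
      zdPlaquetteObs (fundamentalRep (Fin N)) q.1 q.2.1.1 q.2.1.2; μ]| :=
    Summable.of_nonneg_of_le (fun q => abs_nonneg _) hpt hrow.1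
  exact ⟨hsum, (hsum.tsum_le_tsum hpt hrow.1).trans hrow.2⟩

/-- **Extensive energy-variance bound for a ball member**: `PerturbedMassGapAt` ⇒ `Var_μ(Σ_{p∈P} W_p) ≤ χ · #P` for every finite plaquette
set `P` and every DLR state `μ` of the member. [cite: arXiv220412737, Cor. 1.6 (Mass gap)] -/
theorem variance_sum_plaquette_le_of_perturbedMassGapAt (hd : 1 ≤ d) {β : ℝ}
    {W : Potential (ZdEdge d) (Matrix.specialUnitaryGroup (Fin N) ℂ)} {supp : Finset (ZdEdge d) → Finset (Finset (ZdEdge d))}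
    (h : PerturbedMassGapAt d N β W supp) {μ : Measure (LGConfig d (Matrix.specialUnitaryGroup (Fin N) ℂ))}
    (hμ : μ ∈ perturbedGibbsMeasures (d := d) (fundamentalRep (Fin N)) (N * β) W supp) :
    ∃ χ : ℝ, ∀ P : Finset (ZdPlaquette d),
      Var[fun U => ∑ p ∈ P, zdPlaquetteObs (fundamentalRep (Fin N)) p.1 p.2.1.1 p.2.1.2 U; μ] ≤ χ * P.card := by
  classical
  haveI : SecondCountableTopology (Matrix (Fin N) (Fin N) ℂ) :=
    inferInstanceAs (SecondCountableTopology (Fin N → Fin N → ℂ))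
  haveI : SecondCountableTopology (Matrix.specialUnitaryGroup (Fin N) ℂ) :=
    Topology.IsEmbedding.subtypeVal.secondCountableTopology
  have hμ' : IsGibbsMeasure (perturbedYM (d := d) (fundamentalRep (Fin N)) (N * β) W supp) μ := hμ
  haveI := hμ'.isProbabilityMeasure
  obtain ⟨χ, hχ⟩ := summable_abs_cov_plaquette_of_perturbedMassGapAt hd h hμ
  refine ⟨χ, fun P => ?_⟩
  set Wq : ZdPlaquette d → LGConfig d (Matrix.specialUnitaryGroup (Fin N) ℂ) → ℝ :=
    fun p => zdPlaquetteObs (fundamentalRep (Fin N)) p.1 p.2.1.1 p.2.1.2 with hW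
  have hWm : ∀ p : ZdPlaquette d, MemLp (Wq p) 2 μ := fun p =>
    memLp_of_bounded (a := -1) (b := 1)
      (ae_of_all _ fun U => by
        have h1 := abs_zdPlaquetteObs_le fundamentalRep_mem_unitaryGroup p.1 p.2.1.1 p.2.1.2 U
        simp only [Set.mem_Icc]; exact abs_le.1 h1)
      (isLipschitzCylinder_zdPlaquetteObs p.1 p.2.2).measurable.aestronglyMeasurable 2
  have hvar : Var[fun U => ∑ p ∈ P, Wq p U; μ] = ∑ p ∈ P, ∑ q ∈ P, cov[Wq p, Wq q; μ] := by
    have hsum : (fun U => ∑ p ∈ P, Wq p U) = ∑ p ∈ P, Wq p := by funext U; simp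
    rw [hsum, ← covariance_self (memLp_finsetSum' P fun p _ => hWm p).aestronglyMeasurable.aemeasurable,
      covariance_sum_sum' (fun p _ => hWm p) (fun q _ => hWm q)]
  rw [hvar]
  calc ∑ p ∈ P, ∑ q ∈ P, cov[Wq p, Wq q; μ] ≤ ∑ p ∈ P, ∑ q ∈ P, |cov[Wq p, Wq q; μ]| :=
        Finset.sum_le_sum fun p _ => Finset.sum_le_sum fun q _ => le_abs_self _
    _ ≤ ∑ p ∈ P, ∑' q : ZdPlaquette d, |cov[Wq p, Wq q; μ]| :=
        Finset.sum_le_sum fun p _ => (hχ p).1.sum_le_tsum P fun q _ => abs_nonneg _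
    _ ≤ ∑ _p ∈ P, χ := Finset.sum_le_sum fun p _ => (hχ p).2
    _ = χ * P.card := by rw [Finset.sum_const, nsmul_eq_mul, mul_comm]

/-- **C-SUS UNIFORMLY ON THE BALL**: `MassGapOnBallZd d N β ε₀ ε₁ R` ⇒ every DLR state of every member of `MemBallZd ε₀ ε₁ R` has finite
plaquette susceptibility (one bound per state, all base plaquettes). [cite: arXiv220412737, Cor. 1.6 (Mass gap)] -/
theorem summable_abs_cov_plaquette_of_massGapOnBallZd (hd : 1 ≤ d) {β ε₀ ε₁ R : ℝ} (h : MassGapOnBallZd d N β ε₀ ε₁ R)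
    {W : Potential (ZdEdge d) (Matrix.specialUnitaryGroup (Fin N) ℂ)} {supp : Finset (ZdEdge d) → Finset (Finset (ZdEdge d))}
    (hmem : MemBallZd ε₀ ε₁ R W supp) {μ : Measure (LGConfig d (Matrix.specialUnitaryGroup (Fin N) ℂ))}
    (hμ : μ ∈ perturbedGibbsMeasures (d := d) (fundamentalRep (Fin N)) (N * β) W supp) :
    ∃ χ : ℝ, ∀ p : ZdPlaquette d,
      Summable (fun q : ZdPlaquette d => |cov[zdPlaquetteObs (fundamentalRep (Fin N)) p.1 p.2.1.1 p.2.1.2,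
        zdPlaquetteObs (fundamentalRep (Fin N)) q.1 q.2.1.1 q.2.1.2; μ]|) ∧
        ∑' q : ZdPlaquette d, |cov[zdPlaquetteObs (fundamentalRep (Fin N)) p.1 p.2.1.1 p.2.1.2,
        zdPlaquetteObs (fundamentalRep (Fin N)) q.1 q.2.1.1 q.2.1.2; μ]| ≤ χ :=
  summable_abs_cov_plaquette_of_perturbedMassGapAt hd (h W supp hmem) hμ

/-- **Extensive energy-variance bound UNIFORMLY ON THE BALL.** [cite: arXiv220412737, Cor. 1.6 (Mass gap)] -/
theorem variance_sum_plaquette_le_of_massGapOnBallZd (hd : 1 ≤ d) {β ε₀ ε₁ R : ℝ} (h : MassGapOnBallZd d N β ε₀ ε₁ R)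
    {W : Potential (ZdEdge d) (Matrix.specialUnitaryGroup (Fin N) ℂ)} {supp : Finset (ZdEdge d) → Finset (Finset (ZdEdge d))}
    (hmem : MemBallZd ε₀ ε₁ R W supp) {μ : Measure (LGConfig d (Matrix.specialUnitaryGroup (Fin N) ℂ))}
    (hμ : μ ∈ perturbedGibbsMeasures (d := d) (fundamentalRep (Fin N)) (N * β) W supp) :
    ∃ χ : ℝ, ∀ P : Finset (ZdPlaquette d),
      Var[fun U => ∑ p ∈ P, zdPlaquetteObs (fundamentalRep (Fin N)) p.1 p.2.1.1 p.2.1.2 U; μ] ≤ χ * P.card :=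
  variance_sum_plaquette_le_of_perturbedMassGapAt hd (h W supp hmem) hμ

/-- **The lead cell `(β_W, ε) = (1/8, 0.143)` of `SU(2)` on `ℤ⁴`, HYPOTHESIS-FREE** (rb-p1's `su2_rowB_1_8`): every DLR state `μ` of every
member of `MemBallZd (2·0.143) 0.143 R` at bare coupling `β_W/2 = 1/16` has finite plaquette susceptibility and satisfies
`Var_μ(Σ_{p∈P} W_p) ≤ χ · #P`. [cite: arXiv220412737, Cor. 1.6 (Mass gap)] -/
theorem su2_summable_abs_cov_plaquette_ball_1_8 (R : ℝ)
    {W : Potential (ZdEdge 4) (Matrix.specialUnitaryGroup (Fin 2) ℂ)} {supp : Finset (ZdEdge 4) → Finset (Finset (ZdEdge 4))}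
    (hmem : MemBallZd (2 * (143 / 1000)) (143 / 1000) R W supp) {μ : Measure (LGConfig 4 (Matrix.specialUnitaryGroup (Fin 2) ℂ))}
    (hμ : μ ∈ perturbedGibbsMeasures (d := 4) (fundamentalRep (Fin 2)) (2 * ((1 / 8 : ℝ) / 4)) W supp) :
    (∃ χ : ℝ, ∀ p : ZdPlaquette 4,
      Summable (fun q : ZdPlaquette 4 => |cov[zdPlaquetteObs (fundamentalRep (Fin 2)) p.1 p.2.1.1 p.2.1.2,
        zdPlaquetteObs (fundamentalRep (Fin 2)) q.1 q.2.1.1 q.2.1.2; μ]|) ∧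
        ∑' q : ZdPlaquette 4, |cov[zdPlaquetteObs (fundamentalRep (Fin 2)) p.1 p.2.1.1 p.2.1.2,
        zdPlaquetteObs (fundamentalRep (Fin 2)) q.1 q.2.1.1 q.2.1.2; μ]| ≤ χ) ∧
    ∃ χ : ℝ, ∀ P : Finset (ZdPlaquette 4),
      Var[fun U => ∑ p ∈ P, zdPlaquetteObs (fundamentalRep (Fin 2)) p.1 p.2.1.1 p.2.1.2 U; μ] ≤ χ * P.card :=
  ⟨summable_abs_cov_plaquette_of_massGapOnBallZd (by norm_num) (su2_rowB_1_8 R) hmem hμ,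
    variance_sum_plaquette_le_of_massGapOnBallZd (by norm_num) (su2_rowB_1_8 R) hmem hμ⟩

end Summit.Ventures.YMGap.RobustBall.PlaquetteSusceptibilityBall

end
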